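import Summits.RiemannHypothesis.RiemannHypothesis.Theorems.SoloInformedGroundStatePoisson
import Mathlib.NumberTheory.ZetaValues
import Mathlib.Analysis.Real.Pi.Bounds

/-!
# Ground-state endgame, XII: the Poisson bound with explicit constants

Solo programme `solo-RiemannHypothesis-informed`, session 2 (claim C28). Part VII
(`norm_eMapFn_le_rpow`) bounds the E-map image `S_λ(u) = Σ_{n≥1} h(nu/λ)` by `C_α (u/λ)^{α-1}` with a
constant `C_α` coming from idele-class seminorms of `h`, hence not explicit in `h`. For the
doubly-exponential decay of the ground-state energy we need the dependence on `h`: here we prove the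
elementary quantitative version — if `‖𝓕h(ξ)‖ ≤ A ξ⁻²` for `ξ ≥ X` then
`‖S_λ(u)‖ ≤ 3A · u/λ` whenever `X u ≤ λ` — directly from the theta functional equation
`Θ*_h(t) = t⁻¹ Θ*_{𝓕h}(t⁻¹)` and `Σ_{n≥1} n⁻² = π²/6 < 3`.
-/

noncomputable section

open Complex Filter Set Topology MeasureTheory
open scoped FourierTransform
open Literature.NumberTheory.LFunctions Literature.NumberTheory.Automorphic.Meyer

namespace Summit.RiemannHypothesis.RiemannHypothesis.Theorems

/-- `Σ_{n ≥ 1} n⁻² = π²/6`, indexed from `0` as `(n+1)⁻²`. -/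
theorem hasSum_inv_nat_succ_sq :
    HasSum (fun n : ℕ => (1 : ℝ) / ((n + 1 : ℕ) : ℝ) ^ 2) (Real.pi ^ 2 / 6) := by
  have := (hasSum_nat_add_iff' 1).mpr hasSum_zeta_two
  simpa using this

/-- `Σ_{n ≥ 1} n⁻² ≤ 3`. -/
theorem tsum_inv_nat_succ_sq_le : ∑' n : ℕ, (1 : ℝ) / ((n + 1 : ℕ) : ℝ) ^ 2 ≤ 3 := by
  rw [hasSum_inv_nat_succ_sq.tsum_eq]
  nlinarith [Real.pi_lt_four, Real.pi_pos]

/-- Quantitative tail bound for the theta series: if `k` is even with `‖k(y)‖ ≤ A y⁻²` for `y ≥ X`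
(`X > 0`), then `‖Θ*_k(x)‖ ≤ 6A x⁻²` for `x ≥ X`. -/
theorem norm_thetaRest_le_of_decay (k : SchwartzMap ℝ ℂ) (heven : ∀ x, k (-x) = k x)
    {A X : ℝ} (hA : 0 ≤ A) (hX : 0 < X) (hk : ∀ y : ℝ, X ≤ y → ‖k y‖ ≤ A * (y ^ 2)⁻¹)
    {x : ℝ} (hx : X ≤ x) : ‖thetaRest k x‖ ≤ 6 * A * (x ^ 2)⁻¹ := by
  have hx0 : 0 < x := hX.trans_le hx
  have hsum := summable_schwartz_comp_nat_mul k hx0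
  rw [thetaRest_eq k hx0, tsum_int_ite_eq_two_mul_tsum_nat (⇑k) heven hsum, norm_mul,
    show ‖(2 : ℂ)‖ = 2 by norm_num]
  have hterm : ∀ n : ℕ, ‖k (((n + 1 : ℕ) : ℝ) * x)‖
      ≤ A * (x ^ 2)⁻¹ * (1 / ((n + 1 : ℕ) : ℝ) ^ 2) := by
    intro n
    have hn : (1 : ℝ) ≤ ((n + 1 : ℕ) : ℝ) := by exact_mod_cast Nat.succ_pos n
    have hy : X ≤ ((n + 1 : ℕ) : ℝ) * x := hx.trans (le_mul_of_one_le_left hx0.le hn)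
    calc ‖k (((n + 1 : ℕ) : ℝ) * x)‖ ≤ A * ((((n + 1 : ℕ) : ℝ) * x) ^ 2)⁻¹ := hk _ hy
      _ = A * (x ^ 2)⁻¹ * (1 / ((n + 1 : ℕ) : ℝ) ^ 2) := by
          field_simp
  have hS : Summable fun n : ℕ => A * (x ^ 2)⁻¹ * (1 / ((n + 1 : ℕ) : ℝ) ^ 2) :=
    hasSum_inv_nat_succ_sq.summable.mul_left _
  have h1 : ‖∑' n : ℕ, k (((n + 1 : ℕ) : ℝ) * x)‖
      ≤ ∑' n : ℕ, A * (x ^ 2)⁻¹ * (1 / ((n + 1 : ℕ) : ℝ) ^ 2) :=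
    (norm_tsum_le_tsum_norm hsum.norm).trans (hsum.norm.tsum_le_tsum hterm hS)
  rw [tsum_mul_left] at h1
  have h2 := tsum_inv_nat_succ_sq_le
  have hAx : 0 ≤ A * (x ^ 2)⁻¹ := by positivity
  nlinarith

/-- **QUANTITATIVE POISSON BOUND.** For an even Schwartz seed `h` with `h(0) = 0 = ∫ h` whose Fourier
transform satisfies `‖𝓕h(ξ)‖ ≤ A ξ⁻²` for `ξ ≥ X > 0`: `‖S_λ(u)‖ ≤ 3A · (u/λ)` for all `λ, u > 0`
with `X u ≤ λ`. -/
theorem norm_eMapFn_le_of_fourier_decay (h : SchwartzMap ℝ ℂ) (heven : ∀ x, h (-x) = h x)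
    (h0 : h 0 = 0) (hint : ∫ x : ℝ, h x = 0) {A X : ℝ} (hA : 0 ≤ A) (hX : 0 < X)
    (hF : ∀ ξ : ℝ, X ≤ ξ → ‖(𝓕 h : SchwartzMap ℝ ℂ) ξ‖ ≤ A * (ξ ^ 2)⁻¹)
    {lam : ℝ} (hlam : 0 < lam) {u : ℝ} (hu : 0 < u) (hux : X * u ≤ lam) :
    ‖eMapFn h lam u‖ ≤ 3 * A * (lam⁻¹ * u) := by
  have ht : 0 < lam⁻¹ * u := by positivity
  have htinv : (lam⁻¹ * u)⁻¹ = lam / u := by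
    field_simp
  have hXt : X ≤ (lam⁻¹ * u)⁻¹ := by
    rw [htinv, le_div_iff₀ hu]
    exact hux
  have hb := norm_thetaRest_le_of_decay (𝓕 h) (fourier_schwartz_even h heven) hA hX hF hXt
  rw [eMapFn_eq_half_thetaRest h heven hlam hu,
    thetaRest_eq_inv_mul_thetaRest_fourier h heven h0 hint ht, norm_mul, norm_mul, norm_inv,
    Complex.norm_real, Real.norm_eq_abs, abs_of_pos ht, show ‖(1 / 2 : ℂ)‖ = 1 / 2 by norm_num]
  calc 1 / 2 * ((lam⁻¹ * u)⁻¹ * ‖thetaRest (𝓕 h) (lam⁻¹ * u)⁻¹‖)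
        ≤ 1 / 2 * ((lam⁻¹ * u)⁻¹ * (6 * A * (((lam⁻¹ * u)⁻¹) ^ 2)⁻¹)) := by
          gcongr
    _ = 3 * A * (lam⁻¹ * u) := by
          field_simp
          ring

end Summit.RiemannHypothesis.RiemannHypothesis.Theorems
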